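import Mathlib
import Literature.AlgebraicGeometry.Resolution.CobordantGame
import Literature.AlgebraicGeometry.Resolution.CobordantChartCoefficients
import Literature.AlgebraicGeometry.Resolution.CobordantChartPlaneSlice
import Literature.AlgebraicGeometry.Resolution.CobordantTupleGame
import Literature.AlgebraicGeometry.Resolution.FormalCoordinateChange
import Summits.ResolutionOfSingularities.ResolutionOfSingularities.Theorems.WeightedInvariantLocalWeightedDropTerminalDoublePointsDim
import Summits.ResolutionOfSingularities.ResolutionOfSingularities.Theorems.WeightedInvariantLocalWeightedDropSepTerminalDoublePointsDimSteps

/-!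
# `WeightedInvariant.LocalWeightedDrop`: the SEPARABLE terminal double points `y² + A₁ y + A₀` are won — EVERY dimension

Crux item stmt-ResolutionOfSingularities-8899 `LocalWeightedDrop` (route `ResolutionOfSingularities/WeightedInvariant`), skeleton v30,
residual stubs W4|₄ `stub_wildWideApexFourStartsWon` / W4|₅₊ `stub_wildWideApexFiveUpStartsWon` (their `d = 2` slice is the game on
char-2 monic double points `y² + A₁ y + A₀` in `≥ 3` old variables, `wildWideApexHigherStartsWon_two_of_monicForms`).  [OURS · L1 W4.3,
chain w43, stub worker 4 (gen 4): the dimension-generic twin of stub worker 2's S2sT `stub_charTwoSeparableTerminalWon` (p481821, `m = 1`,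
two old variables); together with `TerminalDoublePointDim.terminalDoublePointWon` (the `A₁ = 0` shapes) this is the complete END-GAME of the
`d = 2` wild residual — the positions whose coefficient ideal `(A₀, A₁²)` is principal monomial or «small residual» (the printed notions of
Perlega 2017 §7.3 / Hauser–Perlega 2024 §8 at `c = p = 2`, boundary clauses dropped); replaces the role of the «monomial case» of a
resolution algorithm; NOT a statement of any manuscript.]

THE SHAPES (`x^μ = ∏ x_l^{μ_l}`, `⌈μ/2⌉ = (μ + 1) / 2` slotwise):
* (M1) `sepMonomialDoublePointWon` (EVERY characteristic, every field): `A₀ = x^μ · U`, `U(0) ≠ 0`, `μ ∉ 2ℕ^{m+1}`, `A₁ = x^{⌈μ/2⌉} · B`;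
* (M2) `sepSheetsDoublePointWon` (characteristic `2`, every field; file `…SepTerminalDoublePointsDimSteps`): `A₁ = x^ν · V`, `V(0) ≠ 0`,
  `A₀ = x^{2ν} · W` (two smooth sheets);
* (SR) `sepSmallResidualDoublePointWon` (characteristic `2`, every field): `A₀ = x^{2μ} · g`, `ord g = 1`, `A₁ = x^μ · B`.
NO hypothesis on germs in fewer variables or of lower order is used, and `k` need not be algebraically closed (S2sT used `k = k̄` at
its bottoms through the cone dichotomy; here every bottom is an explicit ONE-MOVE win with no singular successor:
`won_dp1_X_mul_X_mul`, `won_dp1_X_sq_mul`).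

THE STRATEGY (one induction on `Σ μ` resp. `Σ ν` per shape): curve steps `V(x_i, y)` (`SepTerminalDoublePointDim.won_dp1_of_curveStep`)
while permissible — (M1) `μ_i ≥ 2`; (M2) `ν_i ≥ 1` and `ν ≠ e_i`; (SR) `μ_i ≥ 1` unless `μ = e_i ∧ B(0) ≠ 0` — with the slice
transported along `ρ_i(c)` (`subst_rho_prod_X_pow_mul`, `coeff_single_cycleRange_subst_rho`); bottoms: (M1) all `μ_l ≤ 1`: one odd slot =
linear term, two = `won_dp1_X_mul_X_mul`, three or more = the LINE step `won_dp1_of_lineStep` (new in dimension `≥ 3`); (M2) `ν = e_a` =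
`won_dp1_X_sq_mul`, `ν = 0` = the `y`-linear term `V(0)`; (SR) `μ = e_a ∧ B(0) ≠ 0` = `won_dp1_X_sq_mul`, `μ = 0` = a linear term of `g`.

Corollaries: `sepTerminalDoublePointWon` (characteristic `2`, the disjunction in S2sT's shape) and `sepTerminalDoublePointWon_four`
(the `N = 4` instance: separable terminal threefold double points), outside every earlier tree theorem on `CobordantGame.Won k 4`.
-/

set_option linter.dupNamespace false -- mandated namespace of this single-conjunct summit

namespace Summit.ResolutionOfSingularities.ResolutionOfSingularities.Theorems

open Literature.AlgebraicGeometry.Resolution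
open Literature.AlgebraicGeometry.Resolution.CobordantGame

namespace SepTerminalDoublePointDim

open MvPowerSeries TerminalDoublePointDim

variable {k : Type} [Field k] {m : ℕ}

/-! ### (M1) the separable monomial case -/

/-- (M1), induction on `Σ μ ≤ n`. -/
theorem sepMonomialDoublePointWon_aux (p : ℕ) (hp : p.Prime) (k : Type) [Field k] [CharP k p] {m : ℕ} :
    ∀ (n : ℕ) (μ : Fin (m + 1) → ℕ) (U B : MvPowerSeries (Fin (m + 1)) k), ∑ l, μ l ≤ n → constantCoeff U ≠ 0 →
      (∃ l, Odd (μ l)) →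
      CobordantGame.Won k (m + 1 + 1) (X (Fin.last (m + 1)) ^ 2 +
        (rename (Fin.succAboveEmb (Fin.last (m + 1))) ((∏ l, X l ^ μ l) * U) +
          rename (Fin.succAboveEmb (Fin.last (m + 1))) ((∏ l, X l ^ ((μ l + 1) / 2)) * B) * X (Fin.last (m + 1)))) := by
  classical
  intro n
  induction n with
  | zero =>
    intro μ U B hsum _ hodd
    obtain ⟨l₀, ⟨r, hr⟩⟩ := hodd
    exfalso
    have := Finset.single_le_sum (fun l _ => Nat.zero_le (μ l)) (Finset.mem_univ l₀)
    omega
  | succ n IH =>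
    intro μ U B hsum hU hodd
    obtain ⟨l₀, hl₀⟩ := hodd
    by_cases h2 : ∃ i, 2 ≤ μ i
    · -- a curve step at a slot with exponent `≥ 2`
      obtain ⟨i, hi⟩ := h2
      set ν : Fin (m + 1) → ℕ := Function.update μ i (μ i - 2) with hν
      have hsumν : ∑ l, ν l + 2 = ∑ l, μ l := sum_update_sub_add μ i 2 hi
      have hνodd : Odd (ν l₀) := by
        rw [hν]
        by_cases h : l₀ = i
        · subst h
          rw [Function.update_self]
          obtain ⟨r, hr⟩ := hl₀
          exact ⟨r - 1, by omega⟩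
        · rw [Function.update_of_ne h]
          exact hl₀
      have hνpos : 0 < ν l₀ := by obtain ⟨r, hr⟩ := hνodd; omega
      have hνpos' : 0 < (ν l₀ + 1) / 2 := by obtain ⟨r, hr⟩ := hνodd; omega
      refine won_dp1_of_curveStep p hp k i _ ((∏ l, X l ^ ν l) * U) _ ((∏ l, X l ^ ((ν l + 1) / 2)) * B)
        (by rw [← mul_assoc, ← prod_X_pow_eq_mul_prod_update μ i 2 hi])
        (by rw [← mul_assoc, ← prod_X_pow_ceil_eq_X_mul μ i hi])
        (by rw [map_mul, constantCoeff_prod_X_pow_eq_zero ν hνpos, zero_mul])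
        (by rw [map_mul, constantCoeff_prod_X_pow_eq_zero (fun l => (ν l + 1) / 2) hνpos', zero_mul]) ?_
      intro c hc hS
      have hform₀ : C (c ^ 2) * subst (fun l : Fin (m + 1) => if l = i then C c * X 0
          else (X (Fin.predAbove i l.succ) : MvPowerSeries (Fin (m + 1)) k)) ((∏ l, X l ^ ν l) * U) =
          (∏ l, X l ^ ν ((Fin.cycleRange i).symm l)) * (C (c ^ 2) * (C (c ^ ν i) *
            subst (fun l : Fin (m + 1) => if l = i then C c * X 0
              else (X (Fin.predAbove i l.succ) : MvPowerSeries (Fin (m + 1)) k)) U)) := by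
        rw [subst_rho_prod_X_pow_mul]; ring
      have hform₁ : C c * subst (fun l : Fin (m + 1) => if l = i then C c * X 0
          else (X (Fin.predAbove i l.succ) : MvPowerSeries (Fin (m + 1)) k)) ((∏ l, X l ^ ((ν l + 1) / 2)) * B) =
          (∏ l, X l ^ ((ν ((Fin.cycleRange i).symm l) + 1) / 2)) * (C c * (C (c ^ ((ν i + 1) / 2)) *
            subst (fun l : Fin (m + 1) => if l = i then C c * X 0
              else (X (Fin.predAbove i l.succ) : MvPowerSeries (Fin (m + 1)) k)) B)) := by
        rw [subst_rho_prod_X_pow_mul]; ring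
      rw [hform₀, hform₁] at hS ⊢
      refine IH (fun l => ν ((Fin.cycleRange i).symm l)) _ _ ?_ ?_ ⟨Fin.cycleRange i l₀, ?_⟩
      · rw [Equiv.sum_comp (Fin.cycleRange i).symm (fun l => ν l)]
        omega
      · rw [map_mul, map_mul, constantCoeff_C, constantCoeff_C, constantCoeff_subst_rho]
        exact mul_ne_zero (pow_ne_zero _ hc) (mul_ne_zero (pow_ne_zero _ hc) hU)
      · simp only [Equiv.symm_apply_apply]
        exact hνodd
    · -- all exponents `≤ 1`
      push Not at h2
      have hμ1 : ∀ l, μ l ≤ 1 := fun l => Nat.lt_succ_iff.mp (h2 l)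
      have hl₀1 : μ l₀ = 1 := by have := hμ1 l₀; obtain ⟨r, hr⟩ := hl₀; omega
      by_cases hK2 : ∃ b, b ≠ l₀ ∧ μ b = 1
      · obtain ⟨b, hbl₀, hb1⟩ := hK2
        by_cases hK3 : ∃ e, e ≠ l₀ ∧ e ≠ b ∧ μ e = 1
        · -- three odd slots: the line step
          obtain ⟨e, hel₀, heb, he1⟩ := hK3
          exact won_dp1_of_lineStep p hp k μ hμ1 l₀ b e hbl₀.symm hel₀ heb hl₀1 hb1 he1 U hU B
            (fun μ' U' B' hU' hodd' hlt => IH μ' U' B' (by omega) hU' hodd')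
        · -- `K = {l₀, b}`: the hyperbolic bottom with a `y`-term
          push Not at hK3
          have hprod : (∏ l, (X l : MvPowerSeries (Fin (m + 1)) k) ^ μ l) = X l₀ * X b := by
            rw [Finset.prod_eq_mul_prod_sdiff_singleton_of_mem (Finset.mem_univ l₀), hl₀1, pow_one,
              Finset.prod_eq_single_of_mem b (Finset.mem_sdiff.mpr ⟨Finset.mem_univ b, by simpa using hbl₀⟩) ?_, hb1,
              pow_one]
            intro l hl hlb
            have hll₀ : l ≠ l₀ := by simpa using (Finset.mem_sdiff.mp hl).2
            have h0 : μ l = 0 := by have h1 := hμ1 l; have h3 := hK3 l hll₀ hlb; omega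
            rw [h0, pow_zero]
          rw [prod_X_pow_ceil_eq_of_le_one μ hμ1, hprod]
          exact won_dp1_X_mul_X_mul k l₀ b hbl₀.symm hU B
      · -- `K = {l₀}`: a linear term of `A₀`
        push Not at hK2
        have hprod : (∏ l, (X l : MvPowerSeries (Fin (m + 1)) k) ^ μ l) = X l₀ :=
          prod_X_pow_eq_X_of_single μ l₀ hl₀1 (fun l hl => by have h1 := hμ1 l; have h3 := hK2 l hl; omega)
        rw [hprod]
        exact (wonBy_zero_of_not_isSingular (Nat.succ_pos _)
          (not_isSingular_dp1_of_coeff_ne_zero l₀ (by rw [coeff_single_X_mul]; exact hU))).won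

/-- **(M1) THE SEPARABLE MONOMIAL CASE** `y² + x^{⌈μ/2⌉} B · y + x^μ · U` (`U(0) ≠ 0`, `μ ∉ 2ℕ^{m+1}`, `B` arbitrary; `⌈μ/2⌉ = (μ+1)/2`
slotwise) IS WON — every characteristic, every field, every dimension, no hypothesis on other germs. -/
theorem sepMonomialDoublePointWon (p : ℕ) (hp : p.Prime) (k : Type) [Field k] [CharP k p] {m : ℕ} (μ : Fin (m + 1) → ℕ)
    (U B : MvPowerSeries (Fin (m + 1)) k) (hU : constantCoeff U ≠ 0) (hodd : ¬ ∀ l, 2 ∣ μ l) :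
    CobordantGame.Won k (m + 1 + 1) (X (Fin.last (m + 1)) ^ 2 +
      (rename (Fin.succAboveEmb (Fin.last (m + 1))) ((∏ l, X l ^ μ l) * U) +
        rename (Fin.succAboveEmb (Fin.last (m + 1))) ((∏ l, X l ^ ((μ l + 1) / 2)) * B) * X (Fin.last (m + 1)))) := by
  push Not at hodd
  obtain ⟨l, hl⟩ := hodd
  exact sepMonomialDoublePointWon_aux p hp k _ μ U B le_rfl hU ⟨l, Nat.odd_iff.mpr (Nat.two_dvd_ne_zero.mp hl)⟩

/-! ### (SR) the separable small residual case -/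

/-- (SR), induction on `Σ μ ≤ n` (characteristic `2`). -/
theorem sepSmallResidualDoublePointWon_aux (k : Type) [Field k] [CharP k 2] {m : ℕ} :
    ∀ (n : ℕ) (μ : Fin (m + 1) → ℕ) (g B : MvPowerSeries (Fin (m + 1)) k), ∑ l, μ l ≤ n → constantCoeff g = 0 →
      (∃ l, coeff (Finsupp.single l 1) g ≠ 0) →
      CobordantGame.Won k (m + 1 + 1) (X (Fin.last (m + 1)) ^ 2 +
        (rename (Fin.succAboveEmb (Fin.last (m + 1))) ((∏ l, X l ^ (2 * μ l)) * g) +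
          rename (Fin.succAboveEmb (Fin.last (m + 1))) ((∏ l, X l ^ μ l) * B) * X (Fin.last (m + 1)))) := by
  classical
  -- `μ = 0`: a linear term of `g`
  have hbase : ∀ (μ : Fin (m + 1) → ℕ) (g B : MvPowerSeries (Fin (m + 1)) k), (∀ l, μ l = 0) →
      (∃ l, coeff (Finsupp.single l 1) g ≠ 0) →
      CobordantGame.Won k (m + 1 + 1) (X (Fin.last (m + 1)) ^ 2 +
        (rename (Fin.succAboveEmb (Fin.last (m + 1))) ((∏ l, X l ^ (2 * μ l)) * g) +
          rename (Fin.succAboveEmb (Fin.last (m + 1))) ((∏ l, X l ^ μ l) * B) * X (Fin.last (m + 1)))) := by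
    intro μ g B hμ ⟨l, hl⟩
    refine (wonBy_zero_of_not_isSingular (Nat.succ_pos _) (not_isSingular_dp1_of_coeff_ne_zero l ?_)).won
    rw [Finset.prod_eq_one (fun j _ => by rw [hμ j, mul_zero, pow_zero]), one_mul]
    exact hl
  intro n
  induction n with
  | zero =>
    intro μ g B hsum _ hlin
    exact hbase μ g B (fun l => by
      have := Finset.single_le_sum (fun l _ => Nat.zero_le (μ l)) (Finset.mem_univ l); omega) hlin
  | succ n IH =>
    intro μ g B hsum hg0 hlin
    by_cases h1 : ∃ i, 1 ≤ μ i
    · obtain ⟨i, hi⟩ := h1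
      by_cases hbot : constantCoeff B ≠ 0 ∧ μ i = 1 ∧ ∀ l, l ≠ i → μ l = 0
      · -- `μ = e_i`, `B(0) ≠ 0`: the two-sheets bottom with `V = B`, `W = g`
        have hprod₁ : (∏ l, (X l : MvPowerSeries (Fin (m + 1)) k) ^ μ l) = X i :=
          prod_X_pow_eq_X_of_single μ i hbot.2.1 hbot.2.2
        have hprod₂ : (∏ l, (X l : MvPowerSeries (Fin (m + 1)) k) ^ (2 * μ l)) = X i ^ 2 := by
          rw [Finset.prod_eq_single i (fun l _ hl => by rw [hbot.2.2 l hl, mul_zero, pow_zero])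
            (fun h => absurd (Finset.mem_univ i) h), hbot.2.1, mul_one]
        rw [hprod₁, hprod₂]
        exact won_dp1_X_sq_mul k i hbot.1 g
      · -- a curve step at `i`
        set μ' : Fin (m + 1) → ℕ := Function.update μ i (μ i - 1) with hμ'
        have hsumμ : ∑ l, μ' l + 1 = ∑ l, μ l := sum_update_sub_add μ i 1 hi
        have hA₁0 : constantCoeff ((∏ l, (X l : MvPowerSeries (Fin (m + 1)) k) ^ μ' l) * B) = 0 := by
          rw [map_mul]
          by_cases hB : constantCoeff B = 0
          · rw [hB, mul_zero]
          · have hμ'pos : ∃ l, 0 < μ' l := by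
              by_cases h2 : 2 ≤ μ i
              · exact ⟨i, by rw [hμ', Function.update_self]; omega⟩
              · have h1' : μ i = 1 := by omega
                obtain ⟨l, hl⟩ : ∃ l, l ≠ i ∧ μ l ≠ 0 := by
                  by_contra h
                  push Not at h
                  exact hbot ⟨hB, h1', h⟩
                exact ⟨l, by rw [hμ', Function.update_of_ne hl.1]; exact Nat.pos_of_ne_zero hl.2⟩
            obtain ⟨l, hl⟩ := hμ'pos
            rw [constantCoeff_prod_X_pow_eq_zero μ' hl, zero_mul]
        refine won_dp1_of_curveStep 2 Nat.prime_two k i _ ((∏ l, X l ^ (2 * μ' l)) * g) _ ((∏ l, X l ^ μ' l) * B)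
          (by rw [← mul_assoc, ← prod_X_pow_two_mul_eq_X_sq_mul μ i hi])
          (by rw [← mul_assoc, ← pow_one (X i : MvPowerSeries (Fin (m + 1)) k), ← prod_X_pow_eq_mul_prod_update μ i 1 hi])
          (by rw [map_mul, hg0, mul_zero]) hA₁0 ?_
        intro c hc hS
        obtain ⟨l₁, hl₁⟩ := hlin
        have hform₀ : C (c ^ 2) * subst (fun l : Fin (m + 1) => if l = i then C c * X 0
            else (X (Fin.predAbove i l.succ) : MvPowerSeries (Fin (m + 1)) k)) ((∏ l, X l ^ (2 * μ' l)) * g) =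
            (∏ l, X l ^ (2 * μ' ((Fin.cycleRange i).symm l))) * (C (c ^ 2) * (C (c ^ (2 * μ' i)) *
              subst (fun l : Fin (m + 1) => if l = i then C c * X 0
                else (X (Fin.predAbove i l.succ) : MvPowerSeries (Fin (m + 1)) k)) g)) := by
          rw [subst_rho_prod_X_pow_mul]; ring
        have hform₁ : C c * subst (fun l : Fin (m + 1) => if l = i then C c * X 0
            else (X (Fin.predAbove i l.succ) : MvPowerSeries (Fin (m + 1)) k)) ((∏ l, X l ^ μ' l) * B) =
            (∏ l, X l ^ μ' ((Fin.cycleRange i).symm l)) * (C c * (C (c ^ μ' i) *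
              subst (fun l : Fin (m + 1) => if l = i then C c * X 0
                else (X (Fin.predAbove i l.succ) : MvPowerSeries (Fin (m + 1)) k)) B)) := by
          rw [subst_rho_prod_X_pow_mul]; ring
        rw [hform₀, hform₁] at hS ⊢
        refine IH (fun l => μ' ((Fin.cycleRange i).symm l)) _ _ ?_ ?_ ⟨Fin.cycleRange i l₁, ?_⟩
        · rw [Equiv.sum_comp (Fin.cycleRange i).symm (fun l => μ' l)]
          omega
        · rw [map_mul, map_mul, constantCoeff_subst_rho, hg0, mul_zero, mul_zero]
        · rw [coeff_C_mul, coeff_C_mul, coeff_single_cycleRange_subst_rho]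
          refine mul_ne_zero (pow_ne_zero _ hc) (mul_ne_zero (pow_ne_zero _ hc) (mul_ne_zero ?_ hl₁))
          split_ifs
          · exact hc
          · exact one_ne_zero
    · push Not at h1
      exact hbase μ g B (fun l => Nat.lt_one_iff.mp (h1 l)) hlin

/-- **(SR) THE SEPARABLE SMALL RESIDUAL CASE** `y² + x^μ B · y + x^{2μ} · g` (`ord g = 1`, `B` arbitrary) IS WON — characteristic `2`,
every field, every dimension, no hypothesis on other germs. -/
theorem sepSmallResidualDoublePointWon (k : Type) [Field k] [CharP k 2] {m : ℕ} (μ : Fin (m + 1) → ℕ)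
    (g B : MvPowerSeries (Fin (m + 1)) k) (hg : g.order = 1) :
    CobordantGame.Won k (m + 1 + 1) (X (Fin.last (m + 1)) ^ 2 +
      (rename (Fin.succAboveEmb (Fin.last (m + 1))) ((∏ l, X l ^ (2 * μ l)) * g) +
        rename (Fin.succAboveEmb (Fin.last (m + 1))) ((∏ l, X l ^ μ l) * B) * X (Fin.last (m + 1)))) := by
  classical
  obtain ⟨⟨d, hd, hdeg⟩, hlow⟩ := MvPowerSeries.order_eq_nat.mp hg
  have hg0 : constantCoeff g = 0 := by
    rw [← coeff_zero_eq_constantCoeff_apply]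
    exact hlow 0 (by rw [map_zero]; exact zero_lt_one)
  rcases FormalCoordChange.eq_zero_or_single_of_degree_lt_two d (by rw [hdeg]; norm_num) with rfl | ⟨l, rfl⟩
  · rw [map_zero] at hdeg
    exact absurd hdeg zero_ne_one
  · exact sepSmallResidualDoublePointWon_aux k _ μ g B le_rfl hg0 ⟨l, hd⟩

/-! ### The separable terminal double points, every dimension; the `N = 4` instance -/

/-- **THE SEPARABLE TERMINAL DOUBLE POINTS ARE WON** (characteristic `2`, every field, every number `m + 1` of old variables, no
hypothesis on other germs): `y² + A₁ y + A₀` with (M1) `A₀ = x^μ U`, `U(0) ≠ 0`, `μ ∉ 2ℕ^{m+1}`, `A₁ = x^{⌈μ/2⌉} B`; or (M2)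
`A₁ = x^ν V`, `V(0) ≠ 0`, `A₀ = x^{2ν} W`; or (SR) `A₀ = x^{2μ} g`, `ord g = 1`, `A₁ = x^μ B`.  The dimension-generic twin of S2sT
`stub_charTwoSeparableTerminalWon` (there `m = 1` and `k = k̄`; its hypotheses `ord A₀ ≥ 3`, `ord A₁ ≥ 2`, `A₁ ≠ 0` and the lower
germs are idle here as there). [OURS · L1 W4.3 · engine residual W4, `d = 2` end-game] -/
theorem sepTerminalDoublePointWon (k : Type) [Field k] [CharP k 2] {m : ℕ} (A₀ A₁ : MvPowerSeries (Fin (m + 1)) k)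
    (hT : (∃ (μ : Fin (m + 1) → ℕ) (U B : MvPowerSeries (Fin (m + 1)) k), MvPowerSeries.constantCoeff U ≠ 0 ∧ ¬ (∀ l, 2 ∣ μ l) ∧
        A₀ = (∏ l, MvPowerSeries.X l ^ μ l) * U ∧ A₁ = (∏ l, MvPowerSeries.X l ^ ((μ l + 1) / 2)) * B) ∨
      (∃ (ν : Fin (m + 1) → ℕ) (V W : MvPowerSeries (Fin (m + 1)) k), MvPowerSeries.constantCoeff V ≠ 0 ∧
        A₁ = (∏ l, MvPowerSeries.X l ^ ν l) * V ∧ A₀ = (∏ l, MvPowerSeries.X l ^ (2 * ν l)) * W) ∨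
      (∃ (μ : Fin (m + 1) → ℕ) (g B : MvPowerSeries (Fin (m + 1)) k), g.order = 1 ∧
        A₀ = (∏ l, MvPowerSeries.X l ^ (2 * μ l)) * g ∧ A₁ = (∏ l, MvPowerSeries.X l ^ μ l) * B)) :
    CobordantGame.Won k (m + 1 + 1) (MvPowerSeries.X (Fin.last (m + 1)) ^ 2 +
      (MvPowerSeries.rename (Fin.succAboveEmb (Fin.last (m + 1))) A₀ +
        MvPowerSeries.rename (Fin.succAboveEmb (Fin.last (m + 1))) A₁ * MvPowerSeries.X (Fin.last (m + 1)))) := by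
  rcases hT with ⟨μ, U, B, hU, hodd, rfl, rfl⟩ | ⟨ν, V, W, hV, rfl, rfl⟩ | ⟨μ, g, B, hg, rfl, rfl⟩
  · exact sepMonomialDoublePointWon 2 Nat.prime_two k μ U B hU hodd
  · exact sepSheetsDoublePointWon k ν V W hV
  · exact sepSmallResidualDoublePointWon k μ g B hg

end SepTerminalDoublePointDim

open SepTerminalDoublePointDim in
/-- **SEPARABLE TERMINAL THREEFOLD DOUBLE POINTS ARE WON** (the `N = 4` instance; characteristic `2`, every field): `y² + A₁ y + A₀`,
`A_i ∈ k⟦x₀, x₁, x₂⟧`, with `(A₀, A₁)` of shape (M1), (M2) or (SR) is won in `CobordantGame.Won k 4` — with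
`terminalDoublePointWon_four` the complete terminal slice of W4|₄ ∩ {d = 2} (`wildWideApexFourStartsWon_two_of_monicForms`), unconditional
and outside every earlier tree theorem on `Won k 4`. [OURS · L1 W4.3 · engine stmt-ResolutionOfSingularities-8899 residual W4] -/
theorem sepTerminalDoublePointWon_four (k : Type) [Field k] [CharP k 2] (A₀ A₁ : MvPowerSeries (Fin 3) k)
    (hT : (∃ (μ : Fin 3 → ℕ) (U B : MvPowerSeries (Fin 3) k), MvPowerSeries.constantCoeff U ≠ 0 ∧ ¬ (∀ l, 2 ∣ μ l) ∧
        A₀ = (∏ l, MvPowerSeries.X l ^ μ l) * U ∧ A₁ = (∏ l, MvPowerSeries.X l ^ ((μ l + 1) / 2)) * B) ∨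
      (∃ (ν : Fin 3 → ℕ) (V W : MvPowerSeries (Fin 3) k), MvPowerSeries.constantCoeff V ≠ 0 ∧
        A₁ = (∏ l, MvPowerSeries.X l ^ ν l) * V ∧ A₀ = (∏ l, MvPowerSeries.X l ^ (2 * ν l)) * W) ∨
      (∃ (μ : Fin 3 → ℕ) (g B : MvPowerSeries (Fin 3) k), g.order = 1 ∧
        A₀ = (∏ l, MvPowerSeries.X l ^ (2 * μ l)) * g ∧ A₁ = (∏ l, MvPowerSeries.X l ^ μ l) * B)) :
    CobordantGame.Won k 4 (MvPowerSeries.X (Fin.last 3) ^ 2 +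
      (MvPowerSeries.rename (Fin.succAboveEmb (Fin.last 3)) A₀ +
        MvPowerSeries.rename (Fin.succAboveEmb (Fin.last 3)) A₁ * MvPowerSeries.X (Fin.last 3))) :=
  sepTerminalDoublePointWon k (m := 2) A₀ A₁ hT

end Summit.ResolutionOfSingularities.ResolutionOfSingularities.Theorems
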